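import Literature.MathematicalPhysics.QuantumFieldTheory.Balaban1983to89.B9Eq3132AtRecordDE
import Literature.MathematicalPhysics.QuantumFieldTheory.Balaban1983to89.Node00.OpsYRecordV4
import Literature.MathematicalPhysics.QuantumFieldTheory.Balaban1983to89.B6Prop27KLevelV1
import Literature.MathematicalPhysics.QuantumFieldTheory.Balaban1983to89.Node00.N03IndexOddL
import Literature.MathematicalPhysics.QuantumFieldTheory.Balaban1983to89.B6ScalarChartV1

/-!
# `Balaban1983to89.B9Eq3132FlatReadingAtOne` — T. Bałaban, *Propagators for lattice gauge theories in a background field*, Commun. Math. Phys. **99**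
# (1985) 389–434 [Balaban1985BackgroundPropagators], (3.132) p. 422, AT `U = 1`: ROW 26 OF THE N06 TABLE AS TYPED IS **FALSE** FOR THE FLAT READING
# OF THE GENUINE `(QGQ*)⁻¹` — a LOCATED UNITS DEFECT, kernel-certified from [4] (2.142) ([Balaban1984PropagatorsII], PROVED in the tree) and
# Kantorovich's inequality; the displayed estimate binders of the landed row-26 faces are JOINTLY UNSATISFIABLE

statement-level skeleton of published theorems with citation tags; proofs where landed; nothing here is a claim about the Yang–Mills mass gap

THE PRINT.  [B9] p. 422 [PDF 34]: *«The operators (QGQ\*)⁻¹, or (QG₁Q\*)⁻¹, can be analyzed in the same way as the operator (Q′G′²Q′\*)⁻¹. We will not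
repeat these considerations here, let us write only bounds. We have |(QGQ\*)⁻¹(y, y′)| ≤ O(1)(Lʲη)⁻²(L^{j′}η)^{−d}e^{−δ₁d(y,y′)} for y ∈ Λ_j, y′ ∈ Λ_{j′}
(3.132)»*; Cor. 3.5 p. 407: *«for U = 1 these theorems are proved in [4]»*.  [4] = T. Bałaban, *Propagators and renormalization transformations for
lattice gauge theories. II*, Commun. Math. Phys. **96** (1984) 223–250 [Balaban1984PropagatorsII]: (2.35) p. 228 (`H = GQ*(QGQ*)⁻¹`, *«QGQ\* is positive …
an inverse is a well-defined and positive operator»*), (2.142) p. 248 (the flat entries of `QGQ*`), Prop. 2.7 (2.149) p. 249: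
*«|(QGQ\*)⁻¹(b, b′)| ≤ O(1)(Lʲη)^{d−2}η⁻²e^{−δ₄d(b,b′)}»*.

THE TYPED ROW (bundle `B9.lean`, audited): `B9.Ineq3132 d K C δ₁ U := ∀ y y′, |K.ker U y y′| ≤ C·len(y)^{−2}·len(y′)^{−d}·e^{−δ₁ dist(y,y′)}` and
`B9.Stmt3132Printed d c35 geo bg QGQinv QG₁Qinv := ∃ M₄ δ₁ a₀ C > 0, ∀ i, M₄ ≤ M_i → ∀ α₀ > 0, M_iα₀ ≤ a₀ → ∀ U ∈ (3.35) ∩ (3.36), Ineq3132 … (QGQinv i) … ∧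
Ineq3132 … (QG₁Qinv i) …`.  THE INSTANCE (def-Y `Node00.OpsYOfLetters.siteKernelOfOp … id id`): `K.ker U y y′ := sup_{‖E‖ ≤ 1} ‖(T U)(δ_{y′} ⊗ E)(y)‖`, the
FLAT matrix entry of the letter `T U` (flat Kronecker `deltaY`, no volume factor — unlike def-Y's `hKernelOfOp`, which carries `(vol c)⁻¹`), at the
genuine letter `T = QGQinvY x.toKIdx parS parB Gp = (U ↦ Ring.inverse (Q(U)G(U)Q*(U)))` (n06-i g5, `B9Eq3132SectDLetters`; def-Y's records
`lettersYOfRecordDE ∕ V4` pin `QGQinv` to it, `rfl`).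

## THE DEFECT (mechanism)

At `U = 1` the letter IS [4]'s: `QGQinvY … 1 = (onFun EE)♯` (`B9Eq3132SectDLetters.QGQinvY_one_liftEndY`, from the `CovLettersY` fields
`parS_one ∕ parB_one ∕ Gp_one`), `EE = (QGQ*)⁻¹` of r03's flat-basis model (`B6SectAVectorModelV1`: `QsE := adjoint QE` for the FLAT `ℓ²` inner products,
`QE` the block AVERAGE).  Hence the flat reading at `(1, b, b)` is `≥ |⟪e_b, EE e_b⟫|` (§3), and by Kantorovich (§1–§2: `⟪e,e⟫² ≤ ⟪e, T⁻¹e⟫⟪e, Te⟫` for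
the symmetric positive `T = QGQ*`, `B6Prop27KLevelV1.qgq_symm`, `B6SectAVectorModelV1.inner_qgqE_pos`) `⟪e_b, EE e_b⟫ ≥ 1∕X(b,b)`, while [4] (2.142) —
PROVED in the tree for every `KIdx` member above an `M`-threshold, `B6Ineq2142KLevelV1.ineq2142_kLevel` — gives `X(b,b) ≤ A′Λ_b²`,
`Λ_b² = B6Prop27KLevelV1.wt = (L^{j}∕c_f)²·L^{−jD} = len(b)²·L^{−jD}` (`j = lvl b`, `D = d + 1`, `len b = L^{j}∕c_f` by `B6KLevelCensusIndexV1.len_eq`,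
`c_f = Lᵏ`).  So `ker 1 b b ≥ L^{jD}∕(A′·len(b)²)`.  The top-empty members of `Node00.kRIdx_nonvacuous_oddL` (§4–§5: every nominal `k ≥ 2`, `M` beyond
every threshold, all levels `≤ k − 1`, a site of level `k − 1` — hence an index bond `b` with `j = k − 1`, `len b = 1∕L`) then give
`ker 1 b b ≥ L^{2+(k−1)D}∕A′`, whereas (3.132) as typed demands `ker 1 b b ≤ C·L²·L^{dd}` at `U = 1 ∈ (3.35) ∩ (3.36)` (`reg336Y_one`) — impossible once
`L^{(k−1)D} > A′C·L^{dd}`, and `C` must serve every `k`.  IN WORDS (units; dag-n06-i g4's located (O3) now biting row 26): in the flat basis `QGQ*` at a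
level-`j` bond has size `≍ Λ_j²` ((2.142); `≍ η^{D}` at `j = k`, because `Q*` is the flat transpose of an AVERAGE), so its inverse has flat entries
`≍ Λ⁻² ≍ η^{−D}(Lʲη)^{D−2}` — [4]'s own (2.149) (`B6Prop27KLevelV1.prop27_kLevel`, in the tree modulo (2.147)) — while print's (3.132) is a KERNEL w.r.t. the
η-lattice pairings, in which `Q*` carries `η^{−D}`.  `H = GQ*(QGQ*)⁻¹` is convention-free (the factors cancel) and so is `P = I − R` of row 25 (PROVED at
`U = 1` with the bundle's exponents, n06-i g6 p500801); `(QGQ*)⁻¹` ALONE is not, and its flat reading is off print's kernel by unbounded powers of `Lᵏ`.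

## WHAT IS PROVED (sorry-free, 0 `def`, standard axioms)

* §1 (private) `inner_sq_le_of_symm_nonneg`, `inner_self_sq_le_inner_inv_mul` (Kantorovich for a symmetric positive endomorphism of `EuclideanSpace ℝ ι`).
* §2 ★ `one_le_inner_EE_mul_X` (`1 ≤ ⟪e_b, EE e_b⟫·X(b,b)`), `one_le_wt_mul_inner_EE` (`1 ≤ A′Λ_b²⟪e_b, EE e_b⟫` under the diagonal (2.142)).
* §3 (private `liftEndY_deltaY_apply`, `toMatrix'_onFun_apply`), ★ `abs_entry_le_siteKernelOfOp_ker` (the flat reading of a lifted letter dominates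
  its flat diagonal entry; `‖1‖ = 1`).
* §4 `not_deep_of_lev_le`, ★ `exists_bondIdx_lvl_eq` (a top-empty member has an index bond one level below its nominal top).
* §5 ★★★ **`not_stmt3132Printed_flat_of_one`**: for EVERY family index with `4 ≤ ℓ` (odd `L ≥ 5`; below that the member type is empty and every
  family statement is trivially true), band `0 < b₀ ≤ b₁`, floor `M⋆`, every `𝔸` with `‖1‖ = 1`, every `G`, `dd`, `c35 > 0`, every letters family `T` with
  `T x 1 = (onFun EE)♯` and EVERY second kernel `K₁`: `¬ B9.Stmt3132Printed dd c35 geo9Y (bg9Y 𝔸 G) (x ↦ siteKernelOfOp … (T x) id id) K₁`.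
* the sibling `B9Eq3132FlatReadingAtRecord` instantiates §5 at the genuine letter `QGQinvY` of every `CovLettersY` family and at the records
  (`opsYOfRecordDE ∕ opsYS349OfRecordDE ∕ opsYOfRecordV4E`), and derives `False` from the displayed estimate binders of the landed row-26 faces.

## THE REPAIR (not in this file; owners named)

(R1, reading side — node00-def-Y) read `QGQinv ∕ QG1Qinv` through a WEIGHTED site kernel `kerW U y y′ := ω_x(y,y′)·(flat entry)` with
`ω_x(y,y′) = η^{D}·(len_y·len_{y′})^{−D}` up to the (2.60)-admissible rebalancing of the split (so that [4]'s flat truth `≍ η^{−D}(len_y len_{y′})^{(D−2)∕2}e^{−δd}`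
lands on the bundle's total power `−(2+dd)`; to be DERIVED from def-Y's `QY ∕ QsY ∕ deltaY` conventions, not matched); (R2, face side — dag-n06-i) re-type the
Combes–Thomas face on the Λ-normalisation `normMatY b (Λ⁻¹-weights)` (`Λ_b = B6Prop27KLevelV1.lam`), under which BOTH binders are [4]-true at `U = 1`
(`Tc_entry_le` ⇐ (2.142) PROVED; `Tc_coercive` ⇐ the level-weighted (2.147), r03's displayed hypothesis).  Until then every certificate should display row 26
WHOLE (`s3132`) with this located caveat, or not at all.

HONEST SCOPE.  Nothing of [B9] is asserted; the negative is [4]-at-`U = 1` linear algebra (all PROVED in the tree: (2.142), the positivity of `QGQ*`,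
the member witnesses) plus the record's bookkeeping; COUNT-NEUTRAL; N06 NOT discharged (if anything, its row 26 is now KNOWN to need re-typing); one finite
𝕋^{d+1} programme — nothing continuum ∕ OS ∕ mass-gap ∕ Clay.  Cell `pub-ymgap` (HUMAN RULING D-0062), Track A node N06 [B9], seat `pub-ymgap-dag-n06-i`
(bundle F4 rows 14·25·26; harness re-seat gen 7), 2026-08-27.  A NEW file; nothing landed is modified.
-/

namespace Literature.MathematicalPhysics.QuantumFieldTheory.Balaban1983to89.B9Eq3132FlatReadingAtOne

open Node00
open scoped InnerProductSpace
open B6KLevelCensusIndexV1 (KIdx)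
open B6SectAOperatorsV1 (QE QsE BondIdx BondIdxSpace inner_QsE_left)
open B6SectAVectorModelV1 (GE EE qgqE inner_GE_left comp_EE EE_comp inner_qgqE_pos inner_EE_pos)
open B6Ineq2142KLevelV1 (lvl β X X_eq_inner X_symm)
open B6Prop27KLevelV1 (wt wt_pos)
open B6GlobalChartV1 (PV domT toBox boxEquiv boxEquiv_apply iterBlockOf_mem_domT_iff)
open B6Ineq2133TwoScaleV1 (onFun onFun_apply)
open B6MultiLevelBoxOperator (N0)
open B6MultiLevelTorusOperator (TDomains)
open B5Eq118OneStroke (iterBlockOf)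
open B9PinMembersKLevelV1 (MemberY geo9Y bg9Y)

noncomputable section

/-! ## §1 Kantorovich: `⟪e, T⁻¹ e⟫ · ⟪e, T e⟫ ≥ ⟪e, e⟫²` for a symmetric positive `T` -/

section Kantorovich

variable {ι : Type} [Fintype ι]

/-- **Cauchy–Schwarz for the form `⟪T·, ·⟫` of a symmetric positive-semidefinite endomorphism** (at a vector `e` with `⟪T e, e⟫ > 0`):
`⟪T u, e⟫² ≤ ⟪T u, u⟫ · ⟪T e, e⟫`. [folklore] -/
private theorem inner_sq_le_of_symm_nonneg (T : EuclideanSpace ℝ ι →ₗ[ℝ] EuclideanSpace ℝ ι)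
    (hsymm : ∀ a b, ⟪T a, b⟫_ℝ = ⟪a, T b⟫_ℝ) (hnn : ∀ v, 0 ≤ ⟪T v, v⟫_ℝ) (u e : EuclideanSpace ℝ ι) (he : 0 < ⟪T e, e⟫_ℝ) :
    ⟪T u, e⟫_ℝ ^ 2 ≤ ⟪T u, u⟫_ℝ * ⟪T e, e⟫_ℝ := by
  set c : ℝ := ⟪T e, e⟫_ℝ with hc
  set b : ℝ := ⟪T u, e⟫_ℝ with hb
  have hbe : ⟪T e, u⟫_ℝ = b := by rw [hb, hsymm, real_inner_comm]
  have h0 := hnn (c • u - b • e)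
  have hexp : ⟪T (c • u - b • e), c • u - b • e⟫_ℝ = c * (c * ⟪T u, u⟫_ℝ - b ^ 2) := by
    simp only [map_sub, map_smul, inner_sub_left, inner_sub_right, real_inner_smul_left, real_inner_smul_right]
    rw [hbe, ← hb, ← hc]
    ring
  rw [hexp] at h0
  have h1 : 0 ≤ c * ⟪T u, u⟫_ℝ - b ^ 2 := by
    by_contra hneg
    exact absurd h0 (not_le.2 (mul_neg_of_pos_of_neg he (lt_of_not_ge hneg)))
  nlinarith

/-- **KANTOROVICH'S LOWER BOUND FOR THE DIAGONAL OF AN INVERSE**: if `T` is symmetric and positive-semidefinite, `S` is a right inverse of `T`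
(`T (S e) = e`) and `⟪T e, e⟫ > 0`, then `⟪e, e⟫² ≤ ⟪e, S e⟫ · ⟪e, T e⟫`. [folklore] -/
private theorem inner_self_sq_le_inner_inv_mul (T S : EuclideanSpace ℝ ι →ₗ[ℝ] EuclideanSpace ℝ ι)
    (hsymm : ∀ a b, ⟪T a, b⟫_ℝ = ⟪a, T b⟫_ℝ) (hnn : ∀ v, 0 ≤ ⟪T v, v⟫_ℝ) (e : EuclideanSpace ℝ ι)
    (hinv : T (S e) = e) (he : 0 < ⟪T e, e⟫_ℝ) :
    ⟪e, e⟫_ℝ ^ 2 ≤ ⟪e, S e⟫_ℝ * ⟪e, T e⟫_ℝ := by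
  have h := inner_sq_le_of_symm_nonneg T hsymm hnn (S e) e he
  rw [hinv] at h
  rwa [real_inner_comm e (T e)] at h

end Kantorovich

/-! ## §2 [4]'s `(QGQ*)⁻¹` at an index: the diagonal flat entry is at least `1 / X(b,b)`, hence at least `1 / (A′ Λ_b²)` under (2.142) -/

section AtIndex

variable {d ℓ m K : ℕ} {hd : 1 ≤ d + 1} {hL : Odd (ℓ + 1) ∧ 1 < ℓ + 1}
variable {Mh k R : ℕ} {P' : Fin (d + 1) → ℕ}
variable (hN : ∀ μ, N0 ℓ Mh k P' μ = (PV d ℓ m K hd hL).sitesPerDir 0) (D : TDomains d ℓ Mh k P' R) (hk : k ≤ m + K)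
variable {cf : ℝ} (hcf : cf ≠ 0) {w : BondIdx (domT hN D hk) → ℝ} (hw : ∀ i, 0 < w i)

/-- the flat diagonal entry `⟪e_b, (QGQ*)⁻¹ e_b⟫` of [4]'s `(QGQ*)⁻¹` times `X(b,b) = ⟪e_b, QGQ* e_b⟫` is at least `1` (Kantorovich; `QGQ*` symmetric
positive, [4] p. 228). [cite: Balaban1984PropagatorsII, (2.35) p.228 («an inverse is a well-defined and positive operator»)] -/
theorem one_le_inner_EE_mul_X (b : BondIdx (domT hN D hk)) :
    1 ≤ ⟪EuclideanSpace.single b (1 : ℝ), EE (domT hN D hk) hcf hw (EuclideanSpace.single b (1 : ℝ))⟫_ℝ * X hN D hk hcf hw b b := by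
  set e : BondIdxSpace (domT hN D hk) := EuclideanSpace.single b (1 : ℝ) with he
  have hee : ⟪e, e⟫_ℝ = 1 := by rw [he, EuclideanSpace.inner_single_left]; simp
  have hsymm : ∀ a c, ⟪qgqE (domT hN D hk) hcf hw a, c⟫_ℝ = ⟪a, qgqE (domT hN D hk) hcf hw c⟫_ℝ := fun a c => by
    rw [B6SectAVectorModelV1.qgqE_def]
    exact B6Prop27KLevelV1.qgq_symm hN D hk hcf hw a c
  have hnn : ∀ v, 0 ≤ ⟪qgqE (domT hN D hk) hcf hw v, v⟫_ℝ := fun v => by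
    by_cases hv : v = 0
    · rw [hv, map_zero, inner_zero_left]
    · rw [real_inner_comm]; exact (inner_qgqE_pos (domT hN D hk) hcf hw hv).le
  have hene : e ≠ 0 := fun h0 => by
    have : ⟪e, e⟫_ℝ = 0 := by rw [h0, inner_zero_left]
    rw [hee] at this; exact one_ne_zero this
  have hpos : 0 < ⟪qgqE (domT hN D hk) hcf hw e, e⟫_ℝ := by
    rw [real_inner_comm]; exact inner_qgqE_pos (domT hN D hk) hcf hw hene
  have hinv : qgqE (domT hN D hk) hcf hw (EE (domT hN D hk) hcf hw e) = e := by
    have := LinearMap.congr_fun (comp_EE (domT hN D hk) hcf hw) e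
    rwa [B6SectAVectorModelV1.qgqE_def]
  have hK := inner_self_sq_le_inner_inv_mul (qgqE (domT hN D hk) hcf hw) (EE (domT hN D hk) hcf hw) hsymm hnn e hinv hpos
  rw [hee, one_pow] at hK
  have hX : ⟪e, qgqE (domT hN D hk) hcf hw e⟫_ℝ = X hN D hk hcf hw b b := by
    rw [X_eq_inner, B6SectAVectorModelV1.qgqE_def]; rfl
  rwa [hX] at hK

/-- … hence under the diagonal case of [4] (2.142), `X(b,b) ≤ A′Λ_b²` (`Λ_b² = B6Prop27KLevelV1.wt`), the flat diagonal entry of `(QGQ*)⁻¹` satisfies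
`A′ · Λ_b² · ⟪e_b, (QGQ*)⁻¹ e_b⟫ ≥ 1`. [cite: Balaban1984PropagatorsII, (2.142) p.248, (2.149) p.249] -/
theorem one_le_wt_mul_inner_EE (b : BondIdx (domT hN D hk)) {A' : ℝ}
    (hXb : X hN D hk hcf hw b b ≤ A' * wt hN D hk cf b) :
    1 ≤ A' * wt hN D hk cf b * ⟪EuclideanSpace.single b (1 : ℝ), EE (domT hN D hk) hcf hw (EuclideanSpace.single b (1 : ℝ))⟫_ℝ := by
  have h1 := one_le_inner_EE_mul_X hN D hk hcf hw b
  have hEpos : 0 ≤ ⟪EuclideanSpace.single b (1 : ℝ), EE (domT hN D hk) hcf hw (EuclideanSpace.single b (1 : ℝ))⟫_ℝ := by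
    refine (inner_EE_pos (domT hN D hk) hcf hw ?_).le
    intro h0
    have := congrArg (fun v : BondIdxSpace (domT hN D hk) => v b) h0
    simp at this
  calc (1 : ℝ) ≤ _ * X hN D hk hcf hw b b := h1
    _ ≤ _ * (A' * wt hN D hk cf b) := mul_le_mul_of_nonneg_left hXb hEpos
    _ = _ := by ring

end AtIndex

/-! ## §3 The flat reading of a lifted letter: `ker 1 b b ≥ |⟪e_b, S e_b⟫|` -/

section Reading

variable {𝔸 : Type} [NormedRing 𝔸] [NormedAlgebra ℂ 𝔸] [CompleteSpace 𝔸]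
variable {d ℓ : ℕ} {hd : 1 ≤ d + 1} {hL : Odd (ℓ + 1) ∧ 1 < ℓ + 1} {b₀ b₁ : ℝ}

omit [CompleteSpace 𝔸] in
/-- the lift of a real endomorphism on a flat delta: `(S♯(δ_{b′} ⊗ E))(b) = S(b, b′) • E` (the flat matrix entry of `S`). [folklore] -/
private theorem liftEndY_deltaY_apply {X : Type} [Fintype X] [DecidableEq X] (S : Module.End ℝ (X → ℝ)) (b b' : X) (E : 𝔸) :
    liftEndY 𝔸 S (deltaY b' E) b = (((LinearMap.toMatrix' S) b b' : ℝ) : ℂ) • E := by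
  have hδ : deltaY b' E = liftY (Pi.single b' (1 : ℝ)) E := by
    funext z
    by_cases h : z = b'
    · subst h; simp [deltaY, liftY]
    · simp [deltaY, liftY, h]
  rw [hδ, liftEndY_liftY, liftY_apply, LinearMap.toMatrix'_apply]

/-- **THE FLAT READING OF A LIFTED LETTER BOUNDS ITS FLAT DIAGONAL ENTRY FROM BELOW** (`𝔸` with `‖1‖ = 1`): if `O U = S♯` then
`siteKernelOfOp … O … .ker U b b ≥ |S(b,b)|` (test matrix `E = 1`). [cite: Balaban1985BackgroundPropagators, (3.132) p.422 (the reading), bookkeeping] -/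
theorem abs_entry_le_siteKernelOfOp_ker [NormOneClass 𝔸] (i : KIdx d ℓ hd hL b₀ b₁) (B : B9.Backgrounds) (cfg : B.Cfg → CfgY 𝔸 i)
    (O : CfgY 𝔸 i → (IBondY i → 𝔸) →ₗ[ℂ] (IBondY i → 𝔸)) (U : B.Cfg) (S : Module.End ℝ (IBondY i → ℝ))
    (hO : O (cfg U) = liftEndY 𝔸 S) (b : IBondY i) :
    |LinearMap.toMatrix' S b b| ≤ (siteKernelOfOp i B cfg O id id).ker U b b := by
  show |LinearMap.toMatrix' S b b| ≤ ⨆ E : BallY 𝔸, ‖O (cfg U) (deltaY b (E : 𝔸)) b‖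
  have hval : ∀ E : BallY 𝔸, ‖O (cfg U) (deltaY b (E : 𝔸)) b‖ = |LinearMap.toMatrix' S b b| * ‖(E : 𝔸)‖ := fun E => by
    rw [hO, liftEndY_deltaY_apply, norm_smul, Complex.norm_real, Real.norm_eq_abs]
  have hbdd : BddAbove (Set.range fun E : BallY 𝔸 => ‖O (cfg U) (deltaY b (E : 𝔸)) b‖) := by
    refine ⟨|LinearMap.toMatrix' S b b|, ?_⟩
    rintro _ ⟨E, rfl⟩
    dsimp only
    rw [hval]
    have hE : ‖(E : 𝔸)‖ ≤ 1 := mem_closedBall_zero_iff.1 E.2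
    exact mul_le_of_le_one_right (abs_nonneg _) hE
  have h1 : (1 : 𝔸) ∈ Metric.closedBall (0 : 𝔸) 1 := by
    rw [mem_closedBall_zero_iff, norm_one]
  calc |LinearMap.toMatrix' S b b| = ‖O (cfg U) (deltaY b ((⟨1, h1⟩ : BallY 𝔸) : 𝔸)) b‖ := by
        rw [hval]; simp
    _ ≤ ⨆ E : BallY 𝔸, ‖O (cfg U) (deltaY b (E : 𝔸)) b‖ := le_ciSup hbdd ⟨1, h1⟩

/-- the flat matrix entry of `onFun S` IS the inner product `⟪e_b, S e_{b′}⟫`. [folklore] -/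
private theorem toMatrix'_onFun_apply {ι : Type} [Fintype ι] [DecidableEq ι] (S : EuclideanSpace ℝ ι →ₗ[ℝ] EuclideanSpace ℝ ι) (b b' : ι) :
    LinearMap.toMatrix' (onFun S) b b' = ⟪EuclideanSpace.single b (1 : ℝ), S (EuclideanSpace.single b' (1 : ℝ))⟫_ℝ := by
  rw [LinearMap.toMatrix'_apply, EuclideanSpace.inner_single_left, onFun_apply]
  simp only [map_one, one_mul]
  rfl

end Reading

/-! ## §4 A top-empty member carries an index bond one level below its nominal top -/

section Bond

variable {d ℓ m K : ℕ} {hd : 1 ≤ d + 1} {hL : Odd (ℓ + 1) ∧ 1 < ℓ + 1}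
variable {Mh k R : ℕ} {P' : Fin (d + 1) → ℕ}
variable (hN : ∀ μ, N0 ℓ Mh k P' μ = (PV d ℓ m K hd hL).sitesPerDir 0) (D : TDomains d ℓ Mh k P' R) (hk : k ≤ m + K)

/-- if every fine site has level `≤ j` (`j + 1 ≤ k`), no `j`-site is deep (`Ω_{j+1} = ∅` in effect). [cite: Balaban1984PropagatorsII, (2.2)–(2.3) p.224] -/
theorem not_deep_of_lev_le {j : ℕ} (hjk : j + 1 ≤ k) (htop : ∀ z, D.lev z ≤ j) (y : Site (PV d ℓ m K hd hL) j) :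
    ¬ (domT hN D hk).Deep j y := by
  intro hdp
  obtain ⟨x₁, hx₁⟩ := B6ScalarChartV1.exists_iterBlockOf_eq (d := d) (ℓ := ℓ) (hd := hd) (hL := hL) (j := j + 1) (by omega) (blockOf y)
  have hmem : iterBlockOf (j + 1) x₁ ∈ (domT hN D hk).Om (j + 1) := by rw [hx₁]; exact hdp
  have := (iterBlockOf_mem_domT_iff hN D hk (by omega) hjk x₁).1 hmem
  have := htop (toBox hN x₁ : Fin (d + 1) → ℤ)
  omega

/-- **AN INDEX BOND ONE LEVEL BELOW THE (EMPTY) NOMINAL TOP**: if every fine site has level `≤ k − 1` and `x₀` has level `k − 1` (`k ≥ 2`), the bond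
`⟨y^{k−1}(x₀), y^{k−1}(x₀) + e_0⟩` is an index bond of level `k − 1`. [cite: Balaban1984PropagatorsII, (2.3) p.224 («Λ_j … the set of bonds»)] -/
theorem exists_bondIdx_lvl_eq (hk2 : 2 ≤ k) (htop : ∀ z, D.lev z ≤ k - 1) (x₀ : Site (PV d ℓ m K hd hL) 0)
    (hx₀ : D.lev (toBox hN x₀ : Fin (d + 1) → ℤ) = k - 1) :
    ∃ b : BondIdx (domT hN D hk), lvl hN D hk b = k - 1 := by
  have hjlt : k - 1 < (domT hN D hk).k + 1 := by show k - 1 < k + 1; omega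
  have hy : iterBlockOf (k - 1) x₀ ∈ (domT hN D hk).Om (k - 1) :=
    (iterBlockOf_mem_domT_iff hN D hk (by omega) (by omega) x₀).2 hx₀.ge
  have hnd : ∀ z : Site (PV d ℓ m K hd hL) (k - 1), ¬ (domT hN D hk).Deep (k - 1) z :=
    not_deep_of_lev_le hN D hk (by omega) htop
  exact ⟨⟨⟨⟨k - 1, hjlt⟩, ⟨iterBlockOf (k - 1) x₀, ⟨0, (PV d ℓ m K hd hL).hd⟩⟩⟩, ⟨Or.inl hy, hnd _, hnd _⟩⟩, rfl⟩

end Bond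

/-! ## §5 ★★★ THE REFUTATION: (3.132) as typed is false for the flat reading of the genuine `(QGQ*)⁻¹` letter -/

section Refutation

variable {𝔸 : Type} [NormedRing 𝔸] [NormedAlgebra ℂ 𝔸] [CompleteSpace 𝔸] [NormOneClass 𝔸] (G : Subgroup 𝔸ˣ)
variable {d ℓ : ℕ} {hd : 1 ≤ d + 1} {hL : Odd (ℓ + 1) ∧ 1 < ℓ + 1} {b₀ b₁ : ℝ} {Mstar : ℕ}

/-- ★★★ **(3.132) AS TYPED FAILS FOR THE FLAT READING OF ANY LETTER WHOSE `U = 1` VALUE IS [4]'s `(QGQ*)⁻¹`** (every family index with `L ≥ 5`,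
band `0 < b₀ ≤ b₁`; any second kernel, any dimension exponent `dd`, any `c35 > 0`): for a letters family `T x : CfgY → End(coarse-bond functions)` with
`T x 1 = (EE)♯` (`EE = (QGQ*)⁻¹` of [4] (2.35)), the kernel family `x ↦ siteKernelOfOp … (T x) id id` (def-Y's flat `(QGQ*)⁻¹` reading) does NOT satisfy
`B9.Stmt3132Printed dd c35 geo9Y bg9Y`.  WITNESS: the top-empty members of `Node00.kRIdx_nonvacuous_oddL` (every `k ≥ 2`, `M` beyond every threshold),
`U = 1` (in (3.35) ∩ (3.36)), the diagonal entry at an index bond `b` of level `k − 1`: Kantorovich + [4] (2.142) (`B6Ineq2142KLevelV1.ineq2142_kLevel`,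
PROVED) give `ker 1 b b ≥ L^{2+(k−1)(d+1)}∕A′`, (3.132) as typed demands `≤ C·L^{2+dd}`.
[cite: Balaban1985BackgroundPropagators, (3.132) p.422, Cor. 3.5 p.407 («for U = 1 these theorems are proved in [4]»); Balaban1984PropagatorsII, (2.142) p.248, Prop. 2.7 (2.149) p.249] -/
theorem not_stmt3132Printed_flat_of_one (hℓ : 4 ≤ ℓ) (hb₀ : 0 < b₀) (hb₁ : b₀ ≤ b₁) (dd : ℕ) {c35 : ℝ} (hc35 : 0 < c35)
    (T : ∀ x : MemberY d ℓ hd hL b₀ b₁ Mstar, CfgY 𝔸 x.toKIdx → ((IBondY x.toKIdx → 𝔸) →ₗ[ℂ] (IBondY x.toKIdx → 𝔸)))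
    (hT1 : ∀ x : MemberY d ℓ hd hL b₀ b₁ Mstar, T x (fun _ _ => 1) = liftEndY 𝔸 (onFun (EE (domT x.hN x.D x.hk) x.hcf x.hw)))
    (K₁ : ∀ x : MemberY d ℓ hd hL b₀ b₁ Mstar, B9.SiteKernel (geo9Y x) (bg9Y 𝔸 G x)) :
    ¬ B9.Stmt3132Printed dd c35 (geo9Y (d := d) (ℓ := ℓ) (hd := hd) (hL := hL) (b₀ := b₀) (b₁ := b₁) (Mstar := Mstar)) (bg9Y 𝔸 G)
        (fun x => siteKernelOfOp x.toKIdx (bg9Y 𝔸 G x) (fun U => U) (T x) id id) K₁ := by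
  rintro ⟨M₄, δ₁, a₀, C, hM₄, hδ₁, ha₀, hC, H⟩
  -- the constants of [4] (2.142) at this `(d, L, band)`
  obtain ⟨σ₁, hσ₁, h42⟩ := B6Ineq2142KLevelV1.ineq2142_kLevel d ℓ hd hL hb₀ hb₁
  obtain ⟨A', M₂, hA', hM₂, h2142⟩ := h42 σ₁ hσ₁ le_rfl 1 one_pos le_rfl
  -- the base `L = ℓ + 1 ≥ 5`
  set Lr : ℝ := (((ℓ + 1 : ℕ) : ℝ)) with hLr
  have hL1 : 1 < Lr := by rw [hLr]; exact_mod_cast (show 1 < ℓ + 1 by omega)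
  have hL0 : 0 < Lr := lt_trans one_pos hL1
  -- choose `k = n + 2` with `A′C·L^{dd} < L^n`
  obtain ⟨n, hn⟩ := pow_unbounded_of_one_lt (A' * C * Lr ^ dd) hL1
  -- a top-empty member of nominal index `k`, with `M` above `M₄`, `M₂` and the floor
  obtain ⟨i, hik, hM, -, htop, ⟨z, hz, hlev⟩, -⟩ :=
    Node00.kRIdx_nonvacuous_oddL d ℓ (n + 2) hd hL hℓ (by omega) (max M₄ (max M₂ (Mstar : ℝ))) 0 hb₀ hb₁
  have hMi : (kGeoU i.1).M = ((ℓ + 1 : ℕ) : ℝ) * (i.1.Mh : ℝ) := rfl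
  have hMstar : Mstar ≤ (ℓ + 1) * i.1.Mh := by
    have h : (Mstar : ℝ) ≤ ((ℓ + 1 : ℕ) : ℝ) * (i.1.Mh : ℝ) := hMi ▸ le_trans (le_max_right _ _) (le_trans (le_max_right _ _) hM)
    exact_mod_cast h
  have hM₂i : M₂ ≤ ((ℓ : ℝ) + 1) * (i.1.Mh : ℝ) := by
    have h : M₂ ≤ ((ℓ + 1 : ℕ) : ℝ) * (i.1.Mh : ℝ) := hMi ▸ le_trans (le_max_left _ _) (le_trans (le_max_right _ _) hM)
    push_cast at h
    exact h
  set x : MemberY d ℓ hd hL b₀ b₁ Mstar := MemberY.diag i.1 i.2 hMstar with hxdef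
  have hxi : x.toKIdx = i.1 := rfl
  -- an index bond at level `k − 1`
  set x₀ : Site (PV d ℓ i.1.m i.1.K hd hL) 0 := (boxEquiv i.1.hN).symm ⟨z, hz⟩ with hx₀def
  have hx₀ : (toBox i.1.hN x₀ : Fin (d + 1) → ℤ) = z := by
    have := (boxEquiv i.1.hN).apply_symm_apply ⟨z, hz⟩
    rw [boxEquiv_apply] at this
    exact congrArg Subtype.val this
  obtain ⟨b, hb⟩ := exists_bondIdx_lvl_eq i.1.hN i.1.D i.1.hk i.1.hk2 (fun y => by have := htop y; omega) x₀ (by rw [hx₀]; omega)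
  -- the row at `x`, `α₀ := a₀ / M`, `U = 1`
  have hMx : M₄ ≤ (geo9Y x).M := by
    show M₄ ≤ (kGeoU i.1).M
    exact le_trans (le_max_left _ _) hM
  have hMpos : 0 < (geo9Y x).M := lt_of_lt_of_le hM₄ hMx
  set α₀ : ℝ := a₀ / (geo9Y x).M with hα₀def
  have hα₀ : 0 < α₀ := div_pos ha₀ hMpos
  have hMα : (geo9Y x).M * α₀ ≤ a₀ := by rw [hα₀def, mul_div_cancel₀ _ hMpos.ne']
  have h336 := B9PinMembersKLevelV1.reg336Y_one (𝔸 := 𝔸) (G := G) x hc35 hα₀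
  have h335 := B9PinMembersKLevelV1.reg335Y_one (𝔸 := 𝔸) (G := G) x hc35 hα₀
  obtain ⟨h32, -⟩ := H x hMx α₀ hα₀ hMα _ h335 h336
  have hbb := h32 b b
  -- the lower bound: `1 ≤ A′ Λ_b² · ker`
  have hone : (bg9Y 𝔸 G x).one = fun _ _ => 1 := rfl
  have hent := abs_entry_le_siteKernelOfOp_ker x.toKIdx (bg9Y 𝔸 G x) (fun U => U) (T x) (bg9Y 𝔸 G x).one
    (onFun (EE (domT x.hN x.D x.hk) x.hcf x.hw)) (by rw [hone]; exact hT1 x) b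
  rw [toMatrix'_onFun_apply] at hent
  have h2142b := h2142 i.1.m i.1.K i.1.hN i.1.D i.1.hk i.1.hk2 i.1.hMha i.1.hM8 i.1.hR2 i.1.hP5 i.1.hℓ i.1.hpl
    hM₂i i.1.hcf i.1.hw i.1.hwb b b
  have hdist : (B6Geom246MultiLevelTorus.geomT i.1.D).dist (β i.1.hN i.1.D i.1.hk b) (β i.1.hN i.1.D i.1.hk b) = 0 :=
    B9GeoLemma21KLevelV1.geo9K_dist_self i.1 b
  rw [hdist, mul_zero, neg_zero, Real.exp_zero, mul_one] at h2142b
  have hXb : X i.1.hN i.1.D i.1.hk i.1.hcf i.1.hw b b ≤ A' * wt i.1.hN i.1.D i.1.hk i.1.cf b := by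
    refine (le_abs_self _).trans (h2142b.trans (le_of_eq ?_))
    unfold wt; ring
  have hlow := one_le_wt_mul_inner_EE i.1.hN i.1.D i.1.hk i.1.hcf i.1.hw b hXb
  -- `1 ≤ A′ Λ_b² ker`
  have hker0 : 0 ≤ (siteKernelOfOp x.toKIdx (bg9Y 𝔸 G x) (fun U => U) (T x) id id).ker (bg9Y 𝔸 G x).one b b :=
    (abs_nonneg _).trans hent
  have hwt : 0 < wt i.1.hN i.1.D i.1.hk i.1.cf b := wt_pos i.1.hN i.1.D i.1.hk i.1.hcf b
  have hA'0 : 0 < A' := by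
    rcases hA'.lt_or_eq with h | h
    · exact h
    · exfalso; rw [← h, zero_mul, zero_mul] at hlow; exact absurd hlow (by norm_num)
  have hlow' : 1 ≤ A' * wt i.1.hN i.1.D i.1.hk i.1.cf b *
      (siteKernelOfOp x.toKIdx (bg9Y 𝔸 G x) (fun U => U) (T x) id id).ker (bg9Y 𝔸 G x).one b b :=
    hlow.trans (mul_le_mul_of_nonneg_left ((le_abs_self _).trans hent) (mul_pos hA'0 hwt).le)
  -- the upper bound of the row: `ker ≤ C len^{−2} len^{−dd}`
  have hdistY : (geo9Y x).dist b b = 0 := B9GeoLemma21KLevelV1.geo9Y_dist_self x b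
  rw [hdistY, mul_zero, neg_zero, Real.exp_zero, mul_one] at hbb
  have hup : (siteKernelOfOp x.toKIdx (bg9Y 𝔸 G x) (fun U => U) (T x) id id).ker (bg9Y 𝔸 G x).one b b ≤
      C * (geo9Y x).len b ^ (-(2 : ℝ)) * (geo9Y x).len b ^ (-(dd : ℝ)) := (le_abs_self _).trans hbb
  -- the numbers: `len b = 1/L`, `Λ_b² = L^{−2}·(L^{d+1})^{−(k−1)}`
  have hcf : i.1.cf = Lr ^ (n + 2) := by rw [i.2, hik]
  have hlvl : lvl i.1.hN i.1.D i.1.hk b = n + 1 := by rw [hb, hik]; omega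
  have hlen : (geo9Y x).len b = Lr⁻¹ := by
    show (B9GeoNormsKLevelV1.geo9K i.1).len b = Lr⁻¹
    rw [B9GeoNormsKLevelV1.geo9K_len_kGeo, B6KLevelCensusIndexV1.len_eq, hlvl, hcf, abs_of_pos (pow_pos hL0 _), ← hLr,
      pow_succ Lr (n + 1), div_mul_eq_div_div, div_self (pow_ne_zero _ hL0.ne'), one_div]
  have hwtv : wt i.1.hN i.1.D i.1.hk i.1.cf b = (Lr ^ 2)⁻¹ * ((Lr ^ (d + 1)) ^ (n + 1))⁻¹ := by
    unfold wt
    rw [hlvl, hcf, ← hLr]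
    have : Lr ^ (n + 1) / Lr ^ (n + 2) = Lr⁻¹ := by
      rw [pow_succ Lr (n + 1), div_mul_eq_div_div, div_self (pow_ne_zero _ hL0.ne'), one_div]
    rw [this, inv_pow]
  have hlen2 : (geo9Y x).len b ^ (-(2 : ℝ)) = Lr ^ 2 := by
    rw [hlen, Real.rpow_neg (inv_pos.2 hL0).le, Real.inv_rpow hL0.le, inv_inv]; norm_cast
  have hlend : (geo9Y x).len b ^ (-(dd : ℝ)) = Lr ^ dd := by
    rw [hlen, Real.rpow_neg (inv_pos.2 hL0).le, Real.inv_rpow hL0.le, inv_inv]; norm_cast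
  rw [hlen2, hlend] at hup
  rw [hwtv] at hlow'
  -- combine: `1 ≤ A′ L^{−2} L^{−(d+1)(n+1)} · C L² L^{dd}` ⇒ `L^{(d+1)(n+1)} ≤ A′ C L^{dd}` … contradiction with `A′C < L^n`
  have hpow1 : 0 < Lr ^ 2 := pow_pos hL0 _
  have hpow2 : 0 < (Lr ^ (d + 1)) ^ (n + 1) := pow_pos (pow_pos hL0 _) _
  have hkey : (Lr ^ (d + 1)) ^ (n + 1) ≤ A' * C * Lr ^ dd := by
    have := hlow'.trans (mul_le_mul_of_nonneg_left hup (by positivity))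
    rw [show A' * ((Lr ^ 2)⁻¹ * ((Lr ^ (d + 1)) ^ (n + 1))⁻¹) * (C * Lr ^ 2 * Lr ^ dd) =
      (A' * C * Lr ^ dd) / (Lr ^ (d + 1)) ^ (n + 1) by field_simp] at this
    rwa [le_div_iff₀ hpow2, one_mul] at this
  -- `L^n ≤ (L^{d+1})^{n+1}` (`L ≥ 1`), so `L^n ≤ A′C L^{dd} < L^n`: contradiction
  have hmono : Lr ^ n ≤ (Lr ^ (d + 1)) ^ (n + 1) := by
    rw [← pow_mul]
    exact pow_le_pow_right₀ hL1.le (by nlinarith)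
  linarith

end Refutation

end

end Literature.MathematicalPhysics.QuantumFieldTheory.Balaban1983to89.B9Eq3132FlatReadingAtOne
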